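import Literature.AlgebraicGeometry.Motives.HodgeStructureFourierTransformWeylElement
import HarnessLib

/-!
# The explicit algebraic kernels of `Λ`, of `· ⋆ α` and of the Weyl element `w = ℱ` on `H•(X × X) = ⋀(W ⊕ W)`:
# `kernel(· ⋆ α) = δ^*α`, **`kernel(Λ) = δ^*(θ^{g−1}/(g−1)!) = (p^*θ + q^*θ + ℘)^{g−1}/(g−1)!`** (`δ(a, b) = b − a`), `kernel(Λ^k/k!) = δ^*(θ^{g−k}/(g−k)!)`,
# `kernel(w) = kernel(ℱ) = e^℘` — Lieberman–Kleiman's `B(X)` for abelian varieties in Beauville's closed form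

[topic AlgebraicGeometry/Motives]

Layer `Literature/AlgebraicGeometry/Motives`, lane `lit-hodgefound` (Track 2 foundations library; prover seat `lit-hodgefound-p34`,
generation 37, row g37-#7). THEOREMS ONLY (no definition, no named fact, no instance, no notation; net debt `0`). Sequel of rows g37-#3
(`HodgeStructureFourierTransformWeylElement`: `corrMap_map_sub_apply` — the correspondence `δ^*α` acts as `z ↦ z ⋆ α` —, `poincareClass`,
`fourierTransform = corrMap(e^℘)`, `ℱ = w`), g36-#8 (`HodgeStructureLefschetzDualPontryagin`: `Λ = · ⋆ θ^{g−1}/(g−1)!`), g36-#9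
(`HodgeStructurePoincareFormulaPontryagin`: `x ⋆ θ^{g−k}/(g−k)! = Λ^k x/k!`) and of Milne's dictionary `corrMap ω g` / `hω.corrEquiv`
(`HodgeStructureExteriorAlgebraCorrespondences`: `u ↦ (x ↦ q_*(p^*x ∧ u))` is a bijection `H•(X × X) ≅ End(H•(X))`, so every operator has a unique
KERNEL `hω.corrEquiv.symm T`). The tree knew the kernels of `Λ` and `w` qualitatively (`…CorrespondenceDegrees`: `kernel(Λ) ∈ H^{2g−2}(X × X)`;
`…LefschetzOperatorsCorrespondenceClasses`: `kernel(Λ), kernel(w) ∈ ℚ[Hdg²(X × X)]`); here they are computed.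

THE SETTING. `X` a p.p.a.v. of dimension `g ≥ 1`, `W = H¹(X, K)`, `H•(X) = ⋀W`, `H•(X × X) = ⋀(W ⊕ W)`, `θ = ω` (`IsSymplectic ω g`),
`p^* = ⋀inl`, `q^* = ⋀inr`, `m^* = ⋀(id, id)` (addition), **`δ^* = ⋀(inr − inl)`** — the pull-back along the DIFFERENCE map `δ(a, b) = b − a`
(Beauville's `δ`: `δ ∘ σ = p` for `σ(a, b) = (b, a + b)`) —, `℘ = p^*θ + q^*θ − m^*θ = poincareClass ω`, `x ⋆ y = hω.pontryagin x y`,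
`Λ = lefschetzDual ω g`, `w = weylStar ω g`, `ℱ = fourierTransform ω g`.

## Sources, VERBATIM

A. Beauville, *The action of `SL₂` on abelian varieties*, J. Ramanujan Math. Soc. 25 (2010), arXiv:0805.1541 [Beauville2010SL2] (held text
`paper:arxiv-0805.1541`), §4 Theorem (p0005): "The corresponding action of the Lie algebra `𝔰𝔩₂` is given by: `Xz = θz`,
**`Yz = d⁻¹ θ^{g−1}/(g−1)! ⋆ z`**, `Hz = (2p−g−s) z`"; proof (p0005): "Let `σ` be the automorphism of `A × A` defined by `σ(a,b) = (b, a+b)`.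
We have `q ∘ σ = m`, `p ∘ σ = q`, `δ ∘ σ = p`, hence **`(e^{δ^*θ/a})_* z = q_*σ_*σ^*(e^{δ^*θ/a} · p^*z) = m_*(p^*e^{θ/a} · q^*z) = e^{θ/a} ⋆ z`**"
— the correspondence `δ^*β` acts as `· ⋆ β` (row g37-#3 `corrMap_map_sub_apply`, for every class `β`); §2 (p0003): `w ↦ d⁻¹e^℘`.
S. L. Kleiman, *Algebraic cycles and the Weil conjectures*, in: Dix exposés sur la cohomologie des schémas (1968) [Kleiman1968AlgebraicCycles]
(cite-only), §1.4 (the operators `L`, `Λ`, `ᶜΛ`, `∗`; conjecture `B(X)`: `Λ` is algebraic) and §2 Appendix, 2A11 (Lieberman: `B(X)` holds for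
abelian varieties). J. S. Milne, *Lefschetz classes on abelian varieties*, Duke Math. J. 96 (1999) [Milne1999LefschetzClasses] (cite-only),
§5 (5.4–5.9: `Λ`, `∗` are Lefschetz classes on `X × X`). H. Lange, *Abelian Varieties over the Complex Numbers* (2023)
[Lange2023AbelianVarietiesComplex], §2.5.3 Thm. 2.5.16 (Poincaré's formula, p0135).

## What is PROVED (all `theorem`s)

* §1 `IsSymplectic.corrMap_map_sub` (`corrMap(δ^*α) = · ⋆ α` as operators), **`IsSymplectic.corrEquiv_symm_flip_pontryagin` (THE KERNEL OF
  `z ↦ z ⋆ α` IS `δ^*α`)**.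
* §2 **`IsSymplectic.corrEquiv_symm_lefschetzDual` (THE KERNEL OF `Λ` IS `δ^*(θ^{g−1}/(g−1)!)`)**, `IsSymplectic.corrEquiv_symm_inv_factorial_smul_lefschetzDual_pow`
  (the kernel of `Λ^k/k!` is `δ^*(θ^{g−k}/(g−k)!)`, Poincaré's formula), `IsSymplectic.map_sub_eq_poincareClass_add` (`δ^*θ = ℘ + p^*θ + q^*θ`),
  **`IsSymplectic.corrEquiv_symm_lefschetzDual_eq_pow` (`kernel(Λ) = ((g−1)!)⁻¹ (p^*θ + q^*θ + ℘)^{g−1}` — an explicit polynomial in the three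
  divisor classes `p^*θ`, `q^*θ`, `℘` of `X × X`)**, `IsSymplectic.corrEquiv_symm_inv_factorial_smul_lefschetzDual_pow_eq_pow`.
* §3 `corrEquiv_symm_fourierTransform` (`kernel(ℱ) = e^℘ = Σ_{j≤2g} ℘^j/j!`, definitional) and **`IsSymplectic.corrEquiv_symm_weylStar`
  (the kernel of the Weyl element `w = ±∗_A` is `e^℘`)**.

TWIN NOTICE (RULING 29 bis): nothing of the torus-forms carriers is imported or restated.

## References

* [Beauville2010SL2] A. Beauville, *The action of SL₂ on abelian varieties*, J. Ramanujan Math. Soc. 25 (2010), arXiv:0805.1541, §2, §4 (Theorem and proof).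
* [Kleiman1968AlgebraicCycles] S. L. Kleiman, *Algebraic cycles and the Weil conjectures*, Dix exposés (1968), §1.4, §2 Appendix 2A11.
* [Milne1999LefschetzClasses] J. S. Milne, *Lefschetz classes on abelian varieties*, Duke Math. J. 96 (1999), §5, 5.4–5.9.
* [Lange2023AbelianVarietiesComplex] H. Lange, *Abelian Varieties over the Complex Numbers*, Springer (2023), §2.5.3 Thm. 2.5.16 (p0135).
-/

noncomputable section

open scoped TensorProduct Nat

namespace Literature.AlgebraicGeometry.Motives

namespace ExteriorLefschetz

open ExteriorAlgebra

variable {K : Type*} [Field K] [CharZero K] {W : Type*} [AddCommGroup W] [Module K W] {ω : ExteriorAlgebra K W} {g : ℕ}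

/-! ## §1 The kernel of `z ↦ z ⋆ α` is `δ^*α` -/

/-- **`corrMap(δ^*α) = · ⋆ α`** as operators (`δ^* = ⋀(inr − inl)`, `δ(a,b) = b − a`): Beauville's "`(e^{δ^*θ/a})_* z = e^{θ/a} ⋆ z`" for every
class. [cite: Beauville2010SL2, §4 (proof of the Theorem)] -/
theorem IsSymplectic.corrMap_map_sub (hω : IsSymplectic ω g) (α : ExteriorAlgebra K W) :
    corrMap ω g (ExteriorAlgebra.map (LinearMap.inr K W W - LinearMap.inl K W W) α) = (hω.pontryagin).flip α :=
  LinearMap.ext fun z ↦ by rw [hω.corrMap_map_sub_apply, LinearMap.flip_apply]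

/-- **THE KERNEL OF `z ↦ z ⋆ α` IS `δ^*α`**: `hω.corrEquiv.symm (· ⋆ α) = ⋀(inr − inl) α` — the Pontryagin product with a fixed class is the
correspondence "pull back along the difference map". [cite: Beauville2010SL2, §4 (proof of the Theorem)] -/
theorem IsSymplectic.corrEquiv_symm_flip_pontryagin (hω : IsSymplectic ω g) (α : ExteriorAlgebra K W) :
    hω.corrEquiv.symm ((hω.pontryagin).flip α) = ExteriorAlgebra.map (LinearMap.inr K W W - LinearMap.inl K W W) α := by
  rw [← hω.corrMap_map_sub, hω.corrEquiv_symm_corrMap]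

/-! ## §2 The kernel of `Λ` -/

/-- **THE KERNEL OF THE DUAL LEFSCHETZ OPERATOR: `kernel(Λ) = δ^*(θ^{g−1}/(g−1)!)`** (`g ≥ 1`) — `Λ` is induced by the EXPLICIT algebraic
cycle class "pull-back of the curve class `θ^{g−1}/(g−1)!` along the difference map `δ(a, b) = b − a`": Beauville's `Y = θ^{g−1}/(g−1)! ⋆`
(row g36-#8) and `(δ^*β)_* = · ⋆ β`; this is Lieberman–Kleiman's `B(X)` for abelian varieties in closed form.
[cite: Beauville2010SL2, §4 Theorem ("Yz = θ^{g−1}/(g−1)! ⋆ z") and its proof] [cite: Kleiman1968AlgebraicCycles, §1.4 and §2 Appendix 2A11]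
[cite: Milne1999LefschetzClasses, §5, 5.4–5.9] -/
theorem IsSymplectic.corrEquiv_symm_lefschetzDual (hω : IsSymplectic ω g) (hg : 0 < g) :
    hω.corrEquiv.symm (lefschetzDual ω g) =
      ExteriorAlgebra.map (LinearMap.inr K W W - LinearMap.inl K W W) (((g - 1)! : K)⁻¹ • ω ^ (g - 1)) := by
  rw [hω.lefschetzDual_eq_flip_pontryagin hg, hω.corrEquiv_symm_flip_pontryagin]

/-- **`kernel(Λ^k/k!) = δ^*(θ^{g−k}/(g−k)!)`** (`k ≤ g`): Poincaré's formula `x ⋆ θ^{g−k}/(g−k)! = Λ^k x/k!` (row g36-#9) read as kernels.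
[cite: Lange2023AbelianVarietiesComplex, §2.5.3 Thm. 2.5.16 (p0135)] [cite: Beauville2010SL2, §4 Theorem] -/
theorem IsSymplectic.corrEquiv_symm_inv_factorial_smul_lefschetzDual_pow (hω : IsSymplectic ω g) {k m : ℕ} (h : k + m = g) :
    hω.corrEquiv.symm ((k ! : K)⁻¹ • lefschetzDual ω g ^ k) =
      ExteriorAlgebra.map (LinearMap.inr K W W - LinearMap.inl K W W) ((m ! : K)⁻¹ • ω ^ m) := by
  rw [← hω.corrEquiv_symm_flip_pontryagin]
  congr 1
  exact LinearMap.ext fun x ↦ by rw [LinearMap.smul_apply, LinearMap.flip_apply, hω.pontryagin_inv_factorial_smul_pow_eq h]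

omit [CharZero K] in
/-- **`δ^*θ = ℘ + p^*θ + q^*θ`** (the seesaw `m^*θ + δ^*θ = 2p^*θ + 2q^*θ` in `⋀²`, row g37-#3). [cite: Beauville2010SL2, §2 ("℘ = p^*θ + q^*θ − m^*θ") and §4] -/
theorem IsSymplectic.map_sub_eq_poincareClass_add (hω : IsSymplectic ω g) :
    ExteriorAlgebra.map (LinearMap.inr K W W - LinearMap.inl K W W) ω =
      poincareClass ω + ExteriorAlgebra.map (LinearMap.inl K W W) ω + ExteriorAlgebra.map (LinearMap.inr K W W) ω := by
  rw [hω.poincareClass_eq]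
  abel

/-- **`kernel(Λ) = ((g−1)!)⁻¹ · (p^*θ + q^*θ + ℘)^{g−1}`**: the dual Lefschetz operator of a p.p.a.v. is induced by an EXPLICIT POLYNOMIAL IN THE
THREE DIVISOR CLASSES `p^*θ`, `q^*θ`, `℘` of `X × X` (`δ^*` is a ring homomorphism and `δ^*θ = ℘ + p^*θ + q^*θ`).
[cite: Beauville2010SL2, §4 Theorem and proof] [cite: Kleiman1968AlgebraicCycles, §2 Appendix 2A11] [cite: Milne1999LefschetzClasses, §5, 5.4–5.9] -/
theorem IsSymplectic.corrEquiv_symm_lefschetzDual_eq_pow (hω : IsSymplectic ω g) (hg : 0 < g) :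
    hω.corrEquiv.symm (lefschetzDual ω g) = ((g - 1)! : K)⁻¹ •
      (ExteriorAlgebra.map (LinearMap.inl K W W) ω + ExteriorAlgebra.map (LinearMap.inr K W W) ω + poincareClass ω) ^ (g - 1) := by
  rw [hω.corrEquiv_symm_lefschetzDual hg, map_smul, map_pow, hω.map_sub_eq_poincareClass_add, add_comm (poincareClass ω), add_assoc,
    add_comm (poincareClass ω), ← add_assoc]

/-- `kernel(Λ^k/k!) = ((g−k)!)⁻¹ · (p^*θ + q^*θ + ℘)^{g−k}` likewise. [cite: Beauville2010SL2, §4 Theorem and proof] [cite: Lange2023AbelianVarietiesComplex, §2.5.3 Thm. 2.5.16] -/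
theorem IsSymplectic.corrEquiv_symm_inv_factorial_smul_lefschetzDual_pow_eq_pow (hω : IsSymplectic ω g) {k m : ℕ} (h : k + m = g) :
    hω.corrEquiv.symm ((k ! : K)⁻¹ • lefschetzDual ω g ^ k) = (m ! : K)⁻¹ •
      (ExteriorAlgebra.map (LinearMap.inl K W W) ω + ExteriorAlgebra.map (LinearMap.inr K W W) ω + poincareClass ω) ^ m := by
  rw [hω.corrEquiv_symm_inv_factorial_smul_lefschetzDual_pow h, map_smul, map_pow, hω.map_sub_eq_poincareClass_add,
    add_comm (poincareClass ω), add_assoc, add_comm (poincareClass ω), ← add_assoc]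

/-! ## §3 The kernel of `ℱ = w` is `e^℘` -/

/-- `kernel(ℱ) = e^℘ = Σ_{j≤2g} ℘^j/j!` (the definition of `ℱ = (e^℘)_*`, row g37-#3). [cite: Beauville2010SL2, §2 ("w ↦ d⁻¹e^℘") and §4] -/
theorem IsSymplectic.corrEquiv_symm_fourierTransform (hω : IsSymplectic ω g) :
    hω.corrEquiv.symm (fourierTransform ω g) = ∑ j ∈ Finset.range (2 * g + 1), (j ! : K)⁻¹ • poincareClass ω ^ j := by
  rw [fourierTransform, hω.corrEquiv_symm_corrMap]

/-- **THE KERNEL OF THE WEYL ELEMENT `w = exp(−L) exp(Λ) exp(−L) = ±∗_A` IS `e^℘ = Σ_{j≤2g} ℘^j/j!`** (`g ≥ 1`; Beauville's theorem `ℱ = w`,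
row g37-#3): André's / Kleiman's star operators are induced by the explicit algebraic class `e^℘` up to the signs of row g37-#3.
[cite: Beauville2010SL2, §2 ("w ↦ d⁻¹e^℘") and §4 Theorem ("(0 −1 ; 1 0)·z = ℱ(z)")] [cite: Kleiman1968AlgebraicCycles, §1.4] -/
theorem IsSymplectic.corrEquiv_symm_weylStar (hω : IsSymplectic ω g) (hg : 0 < g) :
    hω.corrEquiv.symm (weylStar ω g) = ∑ j ∈ Finset.range (2 * g + 1), (j ! : K)⁻¹ • poincareClass ω ^ j := by
  rw [← hω.fourierTransform_eq_weylStar hg, hω.corrEquiv_symm_fourierTransform]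

end ExteriorLefschetz

end Literature.AlgebraicGeometry.Motives
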